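import Literature.AlgebraicGeometry.Resolution.DiffOpFrobeniusLinear
import Literature.AlgebraicGeometry.Resolution.HasseSchmidtOneVariable
import Mathlib.RingTheory.Adjoin.Basic
import HarnessLib

/-!
# Operators linear over a subring containing `p^N`-th powers are differential operators (characteristic `p`)

Topic `Literature/AlgebraicGeometry/Resolution`; companion of `DiffOpFrobeniusLinear.lean`, which proves the
classical characteristic-`p` fact (Abad 2019, Lemma 6.2 = Giraud 1972) that a differential operator of order `< p^N`
of an `R`-algebra `A` with `(p : A) = 0` is linear over the `p^N`-th powers. This file proves the CONVERSE
direction, at the same elementary level (Grothendieck's commutator definition `IsDiffOpLE` of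
`DifferentialOperators.lean`, EGA IV₄ 16.8.8 (b)):

  Let `S ⊆ A` be any subset and `x₁, …, xₙ ∈ A` with `A = R[S, x₁, …, xₙ]` (as an `R`-algebra) and
  `xᵢ^{p^N} ∈ S` for all `i`. Then every `R`-linear `D : A → A` commuting with the multiplications by the elements
  of `S` (i.e. `S`-linear) is a differential operator of order `≤ n · (p^N − 1)` over `R`.

Typical instance: `S = ρ^N(A) = {g^{p^N}}` the subring of `p^N`-th powers of a ring of characteristic `p` generated
over it by finitely many elements (e.g. a regular local ring essentially of finite type over a perfect field, generated
over `ρ^N(A)` by a regular system of parameters — Kunz): `End_{ρ^N(A)}(A) ⊆ Diff^{≤ n(p^N−1)}_{A/R}`. Together with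
`DiffOpFrobeniusLinear` this says `Diff_{A/R} = ⋃_N End_{ρ^N(A)}(A)` for such `A` (the description of the ring of
differential operators in characteristic `p` through Frobenius powers; cf. Yekutieli, Smith–Van den Bergh; here only the
elementary inclusion is proved, with an explicit order bound).

## Proof (kernel-checked below; elementary)

* `adMul_comm`: the commutator maps `ad_a : D ↦ [D, a]` pairwise commute (`[[D,a],b] = [[D,b],a]`), so `S`-linearity
  is inherited by all iterated commutators.
* `adMul_pow_char_pow_apply`: for EVERY `R`-linear `D` and `(p : A) = 0`, `ad_f^{p^N}(D) = [D, f^{p^N}]` — binomial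
  theorem for the commuting pair (post-composition `λ_f`, `ad_f`), whose sum is pre-composition by `f̂`; the middle
  binomial coefficients `(p^N choose k)`, `0 < k < p^N`, are multiples of `p` (Mathlib `Nat.Prime.dvd_choose_pow`).
  Hence an `S`-linear `D` satisfies `ad_{xᵢ}^{p^N}(D) = [D, xᵢ^{p^N}] = 0`.
* `isDiffOpLE_of_adMul_pow_apply_eq_zero`: if `D` is `S`-linear and `ad_{xᵢ}^{cᵢ}(D) = 0` with `cᵢ ≥ 1`, then `D` has
  order `≤ Σᵢ (cᵢ − 1)` — induction on the budget `Σᵢ (cᵢ − 1)`: the set of `a` with `[D, a]` of order `≤ k` contains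
  `S`, the `xᵢ` (induction hypothesis for `[D, xᵢ]` with budget `c − eᵢ`), the scalars, and is closed under `+` and `·`
  by the Leibniz rule `[D, ab] = [D, a] ∘ b̂ + a • [D, b]`; it is all of `A = R[S, x]`.

## References

* A. Grothendieck, J. Dieudonné, ÉGA IV₄, Publ. Math. IHÉS 32 (1967), §16.8: Déf. 16.8.1, Prop. 16.8.8 (b) (the
  commutator criterion = the tree's `IsDiffOpLE`), Prop. 16.8.9 (orders add). [EGAIV4]
* C. Abad, *p-Bases and differential operators on varieties defined over a non-perfect field*, J. Algebra 523 (2019)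
  217–240, §6 Lemma 6.2 (the direction `Diff^{< p^N} ⊆ End_{A^{p^N}}`; tree `DiffOpFrobeniusLinear.lean`).
  [Abad2019pBases]
* Bearing (index only, nothing asserted from it): H. Hironaka, ms. 2017, Lemma 3.6 / Def. 3.7 p.9–10 (the
  «x-Cartier extension» `∂ = Σ_α x^α σ π_α` of an operator `σ` of `ρ^e(𝒪_ξ)` is `ρ^{e+e′}(𝒪_ξ)`-linear, hence — by the
  present file — a differential operator of `𝒪_ξ` over `𝕂`); campaign res-hironaka, discharge lane, res-D-brk-3's
  roadmap for `S03DiffARNE.Lem3_6`, step (3).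
-/

namespace Literature.AlgebraicGeometry.Resolution

open Finset

section Converse

variable (R : Type*) {A : Type*} [CommSemiring R] [CommRing A] [Algebra R A]

/-! ### Commutator calculus -/

/- `[D, a + b] = [D, a] + [D, b]`, the Leibniz rule `[D, a·b] = [D, a] ∘ b̂ + â ∘ [D, b]` and `[D, r·1] = 0` are the
tree's `commMul_add_right` / `commMul_mul_right` / `commMul_algebraMap` (`HasseSchmidtOneVariable.lean`), reused here. -/

/-- **The commutator maps commute**: `ad_a ∘ ad_b = ad_b ∘ ad_a` on `End_R(A)`, i.e. `[[D, b], a] = [[D, a], b]`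
(multiplications commute with each other; cf. `commMul_commMul_comm` of `DiffOpAdicCompletion.lean` over a ring `R`);
EGA's commutators `D_a` (16.8.8.1). [cite: EGAIV4, Prop. 16.8.8 (16.8.8.1)] -/
theorem adMul_comm (a b : A) : Commute (adMul R a) (adMul R b) := by
  refine LinearMap.ext fun D => ?_
  change commMul R (commMul R D b) a = commMul R (commMul R D a) b
  ext t
  simp only [commMul_apply]
  ring

/-- Iterated commutators with one element commute with a further commutator:
`ad_a^k [D, b] = [ad_a^k D, b]` (EGA's `D_a`, 16.8.8.1, iterated). [cite: EGAIV4, Prop. 16.8.8 (16.8.8.1)] -/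
theorem adMul_pow_apply_commMul (a b : A) (k : ℕ) (D : A →ₗ[R] A) :
    ((adMul R a) ^ k) (commMul R D b) = commMul R (((adMul R a) ^ k) D) b := by
  have h := LinearMap.congr_fun ((adMul_comm R a b).pow_left k).eq D
  rw [Module.End.mul_apply, Module.End.mul_apply] at h
  exact h

/-- If `D` commutes with the multiplication by `s`, so does every iterated commutator `ad_a^k D` (EGA's `D_a`,
16.8.8.1, iterated). [cite: EGAIV4, Prop. 16.8.8 (16.8.8.1)] -/
theorem commMul_adMul_pow_apply_eq_zero {D : A →ₗ[R] A} {s : A} (hs : commMul R D s = 0) (a : A) (k : ℕ) :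
    commMul R (((adMul R a) ^ k) D) s = 0 := by
  rw [← adMul_pow_apply_commMul, hs, map_zero]

/-! ### `ad_f^{p^N} = [·, f^{p^N}]` in characteristic `p` -/

/-- Post-composition powers: `λ_f^k(D) = f̂^k ∘ D` (local copy of the helper of `DiffOpFrobeniusLinear`). [folklore] -/
private theorem mulLeftPost_pow_apply' (f : A) (k : ℕ) (D : A →ₗ[R] A) :
    ((mulLeftPost R f) ^ k) D = LinearMap.mulLeft R (f ^ k) ∘ₗ D := by
  induction k with
  | zero =>
    rw [pow_zero, pow_zero, Module.End.one_apply, LinearMap.mulLeft_one, LinearMap.id_comp]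
  | succ k ih =>
    rw [pow_succ', Module.End.mul_apply, ih]
    change LinearMap.mulLeft R f ∘ₗ (LinearMap.mulLeft R (f ^ k) ∘ₗ D) = _
    rw [← LinearMap.comp_assoc, ← LinearMap.mulLeft_mul, ← pow_succ']

/-- `D ∘ f̂ = (λ_f + ad_f)(D)` (local copy of the helper of `DiffOpFrobeniusLinear`). [folklore] -/
private theorem preMul_eq' (f : A) (D : A →ₗ[R] A) :
    D ∘ₗ LinearMap.mulLeft R f = (mulLeftPost R f + adMul R f) D := by
  rw [LinearMap.add_apply]
  change _ = LinearMap.mulLeft R f ∘ₗ D + commMul R D f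
  rw [commMul]
  abel

/-- `λ_f` and `ad_f` commute (local copy of the helper of `DiffOpFrobeniusLinear`). [folklore] -/
private theorem commute_mulLeftPost_adMul' (f : A) :
    Commute (mulLeftPost R f : Module.End R (A →ₗ[R] A)) (adMul R f) := by
  refine LinearMap.ext fun D => ?_
  rw [Module.End.mul_apply, Module.End.mul_apply]
  change LinearMap.mulLeft R f ∘ₗ commMul R D f = commMul R (LinearMap.mulLeft R f ∘ₗ D) f
  rw [commMul, commMul, LinearMap.comp_sub, LinearMap.comp_assoc]

/-- Pre-composition powers: `(λ_f + ad_f)^k(D) = D ∘ f̂^k` (local copy). [folklore] -/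
private theorem mulLeftPost_add_adMul_pow_apply' (f : A) (k : ℕ) (D : A →ₗ[R] A) :
    ((mulLeftPost R f + adMul R f) ^ k) D = D ∘ₗ LinearMap.mulLeft R (f ^ k) := by
  induction k generalizing D with
  | zero => rw [pow_zero, pow_zero, Module.End.one_apply, LinearMap.mulLeft_one, LinearMap.comp_id]
  | succ k ih =>
    rw [pow_succ, Module.End.mul_apply, ← preMul_eq', ih, LinearMap.comp_assoc, ← LinearMap.mulLeft_mul,
      ← pow_succ']

/-- Middle binomial coefficients of `p^N` kill `R`-linear endomorphisms when `(p : A) = 0` (local copy).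
[folklore] -/
private theorem choose_char_pow_smul_eq_zero' {p : ℕ} (hp : p.Prime) (hA : (p : A) = 0) {N k : ℕ} (hk0 : k ≠ 0)
    (hk : k ≠ p ^ N) (D : A →ₗ[R] A) : ((p ^ N).choose k) • D = 0 := by
  obtain ⟨c, hc⟩ := hp.dvd_choose_pow hk0 hk
  ext t
  rw [LinearMap.smul_apply, LinearMap.zero_apply, hc, mul_smul, nsmul_eq_mul, hA, zero_mul]

/-- **`ad_f^{p^N}(D) = [D, f^{p^N}]`** for EVERY `R`-linear `D` when `(p : A) = 0`: in the binomial expansion of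
`D ∘ f̂^{p^N} = (λ_f + ad_f)^{p^N}(D)` only the two extreme terms `f̂^{p^N} ∘ D` and `ad_f^{p^N}(D)` survive.
(This is the computation in the proof of Abad's Lemma 6.2 = Giraud 1972, valid for every `D`; for `D` of order `< p^N`
the left-hand side vanishes, `DiffOpFrobeniusLinear`.) [cite: Abad2019pBases, Lemma 6.2 (proof)] -/
theorem adMul_pow_char_pow_apply {p : ℕ} (hp : p.Prime) (hA : (p : A) = 0) (f : A) (N : ℕ) (D : A →ₗ[R] A) :
    ((adMul R f) ^ (p ^ N)) D = commMul R D (f ^ p ^ N) := by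
  have hexp := LinearMap.congr_fun ((commute_mulLeftPost_adMul' R f).add_pow (p ^ N)) D
  rw [mulLeftPost_add_adMul_pow_apply', LinearMap.sum_apply, Finset.sum_range_succ, Finset.sum_eq_single 0]
    at hexp
  · simp only [Nat.choose_zero_right, Nat.cast_one, mul_one, Nat.sub_zero, pow_zero, one_mul, Nat.choose_self,
      Nat.sub_self, mulLeftPost_pow_apply'] at hexp
    -- `hexp : D ∘ f̂^{q} = ad_f^{q} D + f̂^{q} ∘ D` (up to the order of the two surviving terms)
    rw [commMul, hexp]
    abel
  · intro k hk hk0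
    rw [Finset.mem_range] at hk
    rw [Module.End.mul_apply, Module.End.mul_apply, Module.End.natCast_apply,
      choose_char_pow_smul_eq_zero' R hp hA hk0 (Nat.ne_of_lt hk) _, map_zero, map_zero]
  · intro h; exact absurd (Finset.mem_range.mpr (pow_pos hp.pos N)) h

/-- Hence an operator commuting with the multiplication by `f^{p^N}` is killed by `ad_f^{p^N}` (the computation of
Abad's Lemma 6.2 read backwards). [cite: Abad2019pBases, Lemma 6.2 (proof)] -/
theorem adMul_pow_char_pow_apply_eq_zero {p : ℕ} (hp : p.Prime) (hA : (p : A) = 0) {f : A} {N : ℕ}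
    {D : A →ₗ[R] A} (h : commMul R D (f ^ p ^ N) = 0) : ((adMul R f) ^ (p ^ N)) D = 0 := by
  rw [adMul_pow_char_pow_apply R hp hA, h]

/-! ### Order `≤ 0` from generators -/

/-- An operator commuting with a generating SET of the `R`-algebra `A` commutes with every multiplication, i.e. has
order `≤ 0`. [cite: EGAIV4, Prop. 16.8.8 (b) (order ≤ 0 = all commutators vanish)] -/
theorem isDiffOpLE_zero_of_commMul_eq_zero_of_adjoin {G : Set A} (hG : Algebra.adjoin R G = ⊤) {D : A →ₗ[R] A}
    (h : ∀ g ∈ G, commMul R D g = 0) : IsDiffOpLE R 0 D := by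
  intro a
  have ha : a ∈ Algebra.adjoin R G := by rw [hG]; exact Algebra.mem_top
  refine Algebra.adjoin_induction (p := fun b _ => commMul R D b = 0) ?_ ?_ ?_ ?_ ha
  · exact h
  · intro r; exact commMul_algebraMap R D r
  · intro b c _ _ hb hc; rw [commMul_add_right, hb, hc, add_zero]
  · intro b c _ _ hb hc
    rw [commMul_mul_right, hb, hc, LinearMap.zero_comp, LinearMap.comp_zero, add_zero]

/-! ### The order bound -/

/-- **Order bound from commutator nilpotency.** Let `A = R[S, x₁, …, xₙ]`. If `D` commutes with the multiplications
by the elements of `S` and `ad_{xᵢ}^{cᵢ}(D) = 0` with `cᵢ ≥ 1` for every `i`, then `D` is a differential operator of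
order `≤ Σᵢ (cᵢ − 1)`. (Induction on the budget `Σᵢ (cᵢ − 1)`; the Leibniz rule `[D, ab] = [D, a] ∘ b̂ + a • [D, b]`
and EGA IV₄ 16.8.9 reduce `[D, a]` for general `a` to the generators.) [cite: EGAIV4, Prop. 16.8.8 (b), Prop. 16.8.9] -/
theorem isDiffOpLE_of_adMul_pow_apply_eq_zero {S : Set A} {ι : Type*} [Fintype ι] [DecidableEq ι] {x : ι → A}
    (hgen : Algebra.adjoin R (S ∪ Set.range x) = ⊤) :
    ∀ (k : ℕ) {D : A →ₗ[R] A}, (∀ s ∈ S, commMul R D s = 0) →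
      ∀ c : ι → ℕ, (∀ i, 1 ≤ c i) → (∀ i, ((adMul R (x i)) ^ (c i)) D = 0) →
        ∑ i, (c i - 1) ≤ k → IsDiffOpLE R k D := by
  intro k
  induction k with
  | zero =>
    intro D hS c hc1 hcD hsum
    -- all budgets are `1`: `D` commutes with every `xᵢ`
    have hci : ∀ i, c i = 1 := by
      intro i
      have h0 : c i - 1 = 0 := by
        have := Finset.sum_eq_zero_iff.mp (Nat.le_zero.mp hsum) i (Finset.mem_univ i)
        exact this
      have := hc1 i
      omega
    refine isDiffOpLE_zero_of_commMul_eq_zero_of_adjoin R hgen fun g hg => ?_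
    rcases hg with hg | ⟨i, rfl⟩
    · exact hS g hg
    · have := hcD i
      rw [hci i, pow_one] at this
      exact this
  | succ k ih =>
    intro D hS c hc1 hcD hsum
    -- Step 1: each `[D, xᵢ]` has order `≤ k`.
    have hx : ∀ i, IsDiffOpLE R k (commMul R D (x i)) := by
      intro i
      by_cases hci : c i = 1
      · -- `ad_{xᵢ} D = 0`
        have h0 : commMul R D (x i) = 0 := by
          have := hcD i
          rw [hci, pow_one] at this
          exact this
        rw [h0]; exact IsDiffOpLE.zero k
      · -- budget `c − eᵢ`
        have hci2 : 2 ≤ c i := by have := hc1 i; omega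
        refine ih (D := commMul R D (x i)) (fun s hs => ?_) (Function.update c i (c i - 1)) ?_ ?_ ?_
        · -- `S`-linearity is inherited
          have := commMul_adMul_pow_apply_eq_zero R (hS s hs) (x i) 1
          rw [pow_one] at this
          exact this
        · intro j
          rcases eq_or_ne j i with rfl | hj
          · rw [Function.update_self]; omega
          · rw [Function.update_of_ne hj]; exact hc1 j
        · intro j
          rcases eq_or_ne j i with rfl | hj
          · rw [Function.update_self]
            have := hcD j
            have hsplit : c j = (c j - 1) + 1 := by omega
            rw [hsplit, pow_succ, Module.End.mul_apply] at this
            exact this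
          · rw [Function.update_of_ne hj]
            change ((adMul R (x j)) ^ c j) ((adMul R (x i)) D) = 0
            have := LinearMap.congr_fun ((adMul_comm R (x j) (x i)).pow_left (c j)).eq D
            rw [Module.End.mul_apply, Module.End.mul_apply] at this
            rw [this, hcD j, map_zero]
        · -- the budget drops by one
          have herase : ∑ j ∈ Finset.univ.erase i, (Function.update c i (c i - 1) j - 1) =
              ∑ j ∈ Finset.univ.erase i, (c j - 1) :=
            Finset.sum_congr rfl fun j hj => by rw [Function.update_of_ne (Finset.ne_of_mem_erase hj)]
          have h1 := Finset.sum_erase_add Finset.univ (fun j => Function.update c i (c i - 1) j - 1)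
            (Finset.mem_univ i)
          have h2 := Finset.sum_erase_add Finset.univ (fun j => c j - 1) (Finset.mem_univ i)
          simp only [Function.update_self] at h1
          rw [herase] at h1
          omega
    -- Step 2: Leibniz over `A = R[S, x]`.
    intro a
    have ha : a ∈ Algebra.adjoin R (S ∪ Set.range x) := by rw [hgen]; exact Algebra.mem_top
    refine Algebra.adjoin_induction (p := fun b _ => IsDiffOpLE R k (commMul R D b)) ?_ ?_ ?_ ?_ ha
    · rintro g (hg | ⟨i, rfl⟩)
      · rw [hS g hg]; exact IsDiffOpLE.zero k
      · exact hx i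
    · intro r; rw [commMul_algebraMap]; exact IsDiffOpLE.zero k
    · intro b b' _ _ hb hb'; rw [commMul_add_right]; exact hb.add hb'
    · intro b b' _ _ hb hb'
      rw [commMul_mul_right]
      have h1 : IsDiffOpLE R k (commMul R D b ∘ₗ LinearMap.mulLeft R b') := by
        simpa using hb.comp (isDiffOpLE_mulLeft (R := R) b')
      have h2 : IsDiffOpLE R k (LinearMap.mulLeft R b ∘ₗ commMul R D b') := by
        simpa using (isDiffOpLE_mulLeft (R := R) b).comp hb'
      exact h1.add h2

/-- **Operators linear over a subring containing the `p^N`-th powers of generators are differential operators.**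
Let `(p : A) = 0`, `S ⊆ A`, `x : ι → A` a finite family with `A = R[S, x]` and `xᵢ^{p^N} ∈ S` for all `i`. Then every
`R`-linear `D : A → A` commuting with the multiplications by the elements of `S` has order `≤ |ι| · (p^N − 1)`.
The converse companion of Abad 2019 Lemma 6.2 (`DiffOpFrobeniusLinear`): for `A` finite over its subring of
`p^N`-th powers, `End_{A^{p^N}}(A) ⊆ Diff^{≤ n(p^N−1)}_{A/R}`. [cite: EGAIV4, Prop. 16.8.8 (b), Prop. 16.8.9] -/
theorem isDiffOpLE_of_commMul_eq_zero_of_pow_char_pow_mem {p : ℕ} (hp : p.Prime) (hA : (p : A) = 0)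
    {S : Set A} {ι : Type*} [Fintype ι] {x : ι → A} (hgen : Algebra.adjoin R (S ∪ Set.range x) = ⊤)
    {N : ℕ} (hxS : ∀ i, x i ^ p ^ N ∈ S) {D : A →ₗ[R] A} (hD : ∀ s ∈ S, commMul R D s = 0) :
    IsDiffOpLE R (Fintype.card ι * (p ^ N - 1)) D := by
  classical
  refine isDiffOpLE_of_adMul_pow_apply_eq_zero R hgen _ hD (fun _ => p ^ N) (fun _ => pow_pos hp.pos N)
    (fun i => adMul_pow_char_pow_apply_eq_zero R hp hA (hD _ (hxS i))) ?_
  rw [Finset.sum_const, Finset.card_univ, smul_eq_mul]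

/-- `CharP` form: in a ring `A` of characteristic `p` generated over `R` by `S` and finitely many `xᵢ` with
`xᵢ^{p^N} ∈ S`, every `S`-linear `R`-endomorphism is a differential operator of order `≤ |ι|(p^N − 1)`.
[cite: EGAIV4, Prop. 16.8.8 (b), Prop. 16.8.9] -/
theorem isDiffOpLE_of_commMul_eq_zero_of_pow_char_pow_mem' (p : ℕ) [Fact p.Prime] [CharP A p]
    {S : Set A} {ι : Type*} [Fintype ι] {x : ι → A} (hgen : Algebra.adjoin R (S ∪ Set.range x) = ⊤)
    {N : ℕ} (hxS : ∀ i, x i ^ p ^ N ∈ S) {D : A →ₗ[R] A} (hD : ∀ s ∈ S, commMul R D s = 0) :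
    IsDiffOpLE R (Fintype.card ι * (p ^ N - 1)) D :=
  isDiffOpLE_of_commMul_eq_zero_of_pow_char_pow_mem R (Fact.out : p.Prime) (CharP.cast_eq_zero A p) hgen hxS hD

end Converse

/-! ### The Frobenius-power subring: `End_{ρ^N(A)}(A) ⊆ Diff_{A/𝕂}` -/

section FrobeniusPowers

variable {𝕂 : Type*} [Field 𝕂] {A : Type*} [CommRing A] [Algebra 𝕂 A]

/-- **`ρ^N(A)`-linear endomorphisms are differential operators.** Let `A` be a commutative `𝕂`-algebra of
characteristic `p`, `S` a `𝕂`-subalgebra whose elements are exactly the `p^N`-th powers (`S = ρ^N(A)`), and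
`x₁, …, xₙ ∈ A` generating `A` over `S` (i.e. `A = 𝕂[S, x]`, e.g. `{x^α}` spans `A` over `S`). Then every
`𝕂`-linear `D : A → A` with `D(s·f) = s·D(f)` for `s ∈ S` lies in `Diff^{≤ n(p^N−1)}_{A/𝕂}`; in particular
`D ∈ Diff_{A/𝕂} = ⋃ₘ Diff^{≤ m}`. (With `DiffOpFrobeniusLinear`: operators of order `< p^N` are `ρ^N(A)`-linear,
so for such `A` the ring of differential operators is `⋃_N End_{ρ^N(A)}(A)`.)
[cite: EGAIV4, Prop. 16.8.8 (b), Prop. 16.8.9] -/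
theorem isDiffOpLE_of_linear_frobeniusPower (p : ℕ) [Fact p.Prime] [CharP A p] {n : ℕ} (x : Fin n → A) (N : ℕ)
    (S : Subalgebra 𝕂 A) (hS : ∀ f : A, f ∈ S ↔ ∃ g : A, g ^ p ^ N = f)
    (hgen : Algebra.adjoin 𝕂 ((S : Set A) ∪ Set.range x) = ⊤)
    (D : A →ₗ[𝕂] A) (hD : ∀ (s : S) (f : A), D ((s : A) * f) = (s : A) * D f) :
    IsDiffOpLE 𝕂 (n * (p ^ N - 1)) D := by
  have h := isDiffOpLE_of_commMul_eq_zero_of_pow_char_pow_mem' 𝕂 p (S := (S : Set A)) hgen (N := N)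
    (fun i => (hS _).mpr ⟨x i, rfl⟩) (D := D) (fun s hs => by
      ext t
      rw [commMul_apply, LinearMap.zero_apply, hD ⟨s, hs⟩ t, sub_self])
  simpa only [Fintype.card_fin] using h

/-- The same with the conclusion `D ∈ Diff_{A/𝕂}` (some finite order), the form consumed by statements quantifying
`∃ m, IsDiffOpLE 𝕂 m D`. [cite: EGAIV4, Prop. 16.8.8 (b), Prop. 16.8.9] -/
theorem exists_isDiffOpLE_of_linear_frobeniusPower (p : ℕ) [Fact p.Prime] [CharP A p] {n : ℕ} (x : Fin n → A)
    (N : ℕ) (S : Subalgebra 𝕂 A) (hS : ∀ f : A, f ∈ S ↔ ∃ g : A, g ^ p ^ N = f)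
    (hgen : Algebra.adjoin 𝕂 ((S : Set A) ∪ Set.range x) = ⊤)
    (D : A →ₗ[𝕂] A) (hD : ∀ (s : S) (f : A), D ((s : A) * f) = (s : A) * D f) :
    ∃ m, IsDiffOpLE 𝕂 m D :=
  ⟨_, isDiffOpLE_of_linear_frobeniusPower p x N S hS hgen D hD⟩

end FrobeniusPowers

end Literature.AlgebraicGeometry.Resolution
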